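import Summits.Parity.GeneralizedHardyLittlewood.Theorems.GoldbachHeathBrownDispersionHeathBrownMorozUniformH310
import Summits.Parity.GeneralizedHardyLittlewood.Theorems.GoldbachHeathBrownDispersionHeathBrownMorozUniformH39
import HarnessLib

/-!
# Crux `HeathBrownMorozUniform` (stmt-Parity-19915) of route `GoldbachHeathBrownDispersion` — PROVED

Heath-Brown–Moroz, *On the representation of primes by cubic polynomials in two variables*, Proc. LMS 88
(2004), Theorem 2 for `x³ + 2y³` in the FINITE-UNIFORM form of the route (for every `Q` one box exponent `c`
and the singular-series limit `σ₀` with, for every modulus `d ≤ Q` and admissible class `(a, b)`,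
`#{primes ≡ class} = w(d)·(main term)(1 + o(1))`): the kernel re-run of Heath-Brown's Acta Math. 186 (2001)
proof for the residue-class family `classPairs X η d a b` — reduction layer and finite max
(`…Reduction`, `…OfClassLemmas`, `…OfTwoClassLemmas`), class Lemma 3.5 (`class_lemma_3_5`), class leading
parts `class_h39` (S3 `classSigmaOneCoprime`, S4a, S4b `classDisplay104_of_…`, EQ39 glue) and the class Type II
estimate `class_h310` (E3 `stub_classMainError`, E4 `stub_classMainCauchy`, E5 `stub_twistedSsum` — the twisted
§§11–13 `CubicSieve.Twisted.*` with hypothesis (3.14) at level `d·Q₁`). This file is the one-line composition;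
its type is literally the route decl. Goldbach is NOT proved by this (FRONTIER formalisation rung F-P1b: an
INPUT of the almost-all statement `GoldbachHeathBrownAlmostAll`).

## References

* D. R. Heath-Brown, B. Z. Moroz, Proc. London Math. Soc. 88 (2004), Theorem 2. [cite: HeathBrownMoroz2004, Theorem 2]
* D. R. Heath-Brown, Acta Math. 186 (2001), Theorem 1 and §3. [cite: HeathBrownActa2001, Theorem 1]
-/

noncomputable section

namespace Summit.Parity.GeneralizedHardyLittlewood.Theorems

open GoldbachHeathBrownDispersionHeathBrownMorozUniform

/-- **`HeathBrownMorozUniform` (stmt-Parity-19915) holds** — Heath-Brown–Moroz 2004, Theorem 2 for `x³ + 2y³`,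
finite-uniform in the classes of each modulus `d ≤ Q`: `class_h39` (class Lemma 3.9) and `class_h310`
(class Lemma 3.10) fed to `heathBrownMorozUniform_of_twoClassLemmas`. Goldbach is not proved by this.
[cite: HeathBrownMoroz2004, Theorem 2] -/
theorem goldbachHeathBrownDispersion_heathBrownMorozUniform_proof :
    Summit.Parity.GeneralizedHardyLittlewood.Theses.GoldbachHeathBrownDispersion.HeathBrownMorozUniform :=
  heathBrownMorozUniform_of_h39 class_h39

end Summit.Parity.GeneralizedHardyLittlewood.Theorems

end
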